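import Summits.QuantumFields.BalabanUV.Beta.GAN24.EnvelopeBlockSum

/-!
# `BalabanUV.Beta.GAN24.ThreeLegFreezeBricks` — binder row G-an2-4 ∕ (CONV-C), W-slot, the (α-0) parity re-cut, located crux (Q-L-k₀)
# (RULING R-gan24p1-g35-1 (2)(b2), amended by leaf-01 g74's COUNT C-leaf01-g74-1, journal l.53136): **BRICKS FOR THE THREE-LEG CORE** —
# the SHARP WOBBLE of the block label, envelope ∕ Lipschitz transfers at rate `κ₀/L`, the block-position sum against a decay, sup × decay and
# first-moment × decay sums, and the block-summed table ∕ slot charges RE-CENTRED AT THE KERNEL SITE (part 1 of 3; part 2 = `GAN24/ThreeLegDoubleFreeze`, part 3 = `GAN24/ThreeLegDoubleFreezeSummable`)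

NOT IN PRINT; OUR PROOF ([folklore] real analysis over leaf-12's `LatticeFreeze` ∕ `EnvelopeBlockSum`; 0 `def`, 0 cited facts, 0 `def … : Prop`, 0 sorry,
0 wall binders).  HONEST FRAMING (cell contract, verbatim): «discharging `BetaPertH` makes Bałaban's UV stability UNCONDITIONAL — a real constructive-QFT
result; it is NOT the continuum limit and NOT the Clay problem.»  HONEST DEPENDENCY (verbatim): «continuum YM on T⁴ ⇐ BetaPertH ∧ nine spine estimates
(0/9 proved); BetaPertH ⇐ (D1) ∧ (D4) ∧ CAP+tail; G-an2-4 gates asym, D1 and NE2/3/4.»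

## Why a second bookkeeping next to `Push4Irr`'s
leaf-03's (Q-L) socket (`LegTowerSlavedRows.good_window`) ITERATES its window hypothesis (H1♮), so the core must return the table's OWN rate `δ`.
`Push4Irr`'s relative-form envelopes (`leg_rel_sup`, growth `e^{κ₀|·|₁}`) need a table rate `δ > κ₀` and return `κ₀/(6(d+1)) < δ`; here the envelopes are
transferred at the TRUE cost of the block label, `‖quo L u − quo L v‖∞ ≤ |u − v|₁/L + 1` (§1) — growth `e^{(κ₀/L)|·|₁}`, absorbed by any table rate `δ ≥ 6κ₀/L` —
and the output decay comes from the legs alone (`EnvelopeBlockSum.tsum_env4_le`, block sup-rate `κ₀/6`, which is `≥ δ` in `ℓ¹` once `δ ≤ κ₀/(6(d+1))`).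

## What is proved (generic `d`; `E_c(v) = e^{−κ₀‖quo L v − c‖∞}`)
* §1 `abs_ediv_sub_ediv_le_div_add_one`, **`supNorm_quo_sub_quo_le_div`** (the sharp wobble), `env_transfer` (`E_c(v) ≤ e^{κ₀}·e^{(κ₀/L)|v−u|₁}·E_c(u)`),
  `abs_sub_le_transfer` (a unit-gradient envelope `a′·E_c` gives `|h v − h u| ≤ (a′e^{κ₀}E_c(u))·|v−u|₁·e^{κ|v−u|₁}` for any `κ ≥ κ₀/L`),
  **`sum_box_exp_le`** (`Σ_{t ∈ box L} e^{−δ′|L•c + t − x|₁} ≤ e^{κ₀}·E_c(x)·Zl(δ′ − κ)`: the position block sum costs a lattice constant and RETURNS the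
  position envelope at `x`).
* §2 `abs_tsum_sup_mul_le` (sup × decay), `abs_tsum_moment_mul_le` (first moment × decay, `LatticeFreeze.mul_exp_neg_le`), `recenter₃` ∕ `recenter₂`
  (the table's decay re-centred from its first slot to the kernel site, rate `δ → δ/3`).
* §3 under the core's standing hypotheses (legs `h₁ h₂ ρ`, table `W`, slot charges `g`, block label `c₄`, `κ₀ ≤ (δ/6)·L`): `abs_boxW_le` (the block-summed
  table `≤ (C·e^{κ₀}·Zl(δ/6)·E_{c₄}(x))·e^{−(δ/3)|v−x|₁}·e^{−(δ/3)|v′−x|₁}`), `abs_boxq₂_le` ∕ `abs_boxq₁_le` ∕ `abs_boxq₁₂_le` (the block-summed slot charges).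
Asserts NOTHING about Bałaban's tables or legs; discharges NOTHING of (Q-L) ∕ (H1♮) ∕ (C) ∕ «T2Shape» ∕ «T2Drift» ∕ (hW, hWall); NEVER «G-an2-4 closed» as
(CONV-C); NOT D1, NOT `BetaPertH`, NOT continuum, NOT Clay; not in print.
Unit `b2b-balaban-gan24-formalise-leaf-01` (G-an2-4 formalisation swarm, leaf prover 01, gen 74), 2026-08-23.
-/

noncomputable section

open Finset
open scoped BigOperators
open Literature.MathematicalPhysics.QuantumFieldTheory.LatticeForm (quo)
open Literature.MathematicalPhysics.QuantumFieldTheory.Balaban1983to89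
open Literature.MathematicalPhysics.QuantumFieldTheory.Balaban1983to89.Beta
open B4ContourShift (supNorm abs_le_supNorm supNorm_nonneg exists_supNorm_eq)
open B4Reflection242 (supNorm_le_of_forall supNorm_add_le)
open B12Sec2to5 (l1 l1_nonneg)
open ExpKernelCalculus (Zl Zl_nonneg Zl_pos summable_exp_shift summable_exp_shift' tsum_exp_shift tsum_exp_shift' l1_sub_triangle l1_sub_symm)
open AffineAveraging (box toSite)
open KKTFluctuationEnergy (quo_zsmul_add_toSite)
open KernelWard (ProdBound tsum_comm_of_prodBound)
open Summit.QuantumFields.BalabanUV.Beta.GAN24.LatticeFreeze (mul_exp_neg_le abs_sub_le_of_unit_steps)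
open Summit.QuantumFields.BalabanUV.Beta.GAN24.EnvelopeBlockSum (env_le_one summable_env tsum_env4_le)

namespace Summit.QuantumFields.BalabanUV.Beta.GAN24.ThreeLegFreezeBricks

variable {d : ℕ}

/-! ## §1 The sharp wobble and the transfers -/

/-- [folklore] Euclidean division by `L ≥ 1` contracts distances up to one unit: `|a/L − b/L| ≤ |a − b|/L + 1` (as reals). -/
theorem abs_ediv_sub_ediv_le_div_add_one {L : ℕ} (hL : 1 ≤ L) (a b : ℤ) :
    |(((a / (L : ℤ) : ℤ) : ℝ)) - (((b / (L : ℤ) : ℤ) : ℝ))| ≤ |((a - b : ℤ) : ℝ)| / (L : ℝ) + 1 := by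
  have hL0 : (0 : ℤ) < L := by exact_mod_cast hL
  have hLr : (0 : ℝ) < (L : ℝ) := by exact_mod_cast hL
  have ha := Int.mul_ediv_add_emod a (L : ℤ)
  have hb := Int.mul_ediv_add_emod b (L : ℤ)
  have ha0 := Int.emod_nonneg a hL0.ne'
  have hb0 := Int.emod_nonneg b hL0.ne'
  have haL := Int.emod_lt_of_pos a hL0
  have hbL := Int.emod_lt_of_pos b hL0
  -- `L·(a/L − b/L) = (a − b) − (a%L − b%L)` with `|a%L − b%L| < L`
  set D : ℝ := (((a / (L : ℤ) : ℤ) : ℝ)) - (((b / (L : ℤ) : ℤ) : ℝ)) with hD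
  have key : (L : ℝ) * D = ((a - b : ℤ) : ℝ) - (((a % (L : ℤ) : ℤ) : ℝ) - ((b % (L : ℤ) : ℤ) : ℝ)) := by
    have ha' : (L : ℝ) * ((a / (L : ℤ) : ℤ) : ℝ) + ((a % (L : ℤ) : ℤ) : ℝ) = (a : ℝ) := by exact_mod_cast ha
    have hb' : (L : ℝ) * ((b / (L : ℤ) : ℤ) : ℝ) + ((b % (L : ℤ) : ℤ) : ℝ) = (b : ℝ) := by exact_mod_cast hb
    rw [hD]; push_cast; linarith
  have hr : |(((a % (L : ℤ) : ℤ) : ℝ) - ((b % (L : ℤ) : ℤ) : ℝ))| ≤ (L : ℝ) := by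
    have h1 : (0 : ℝ) ≤ ((a % (L : ℤ) : ℤ) : ℝ) := by exact_mod_cast ha0
    have h2 : (0 : ℝ) ≤ ((b % (L : ℤ) : ℤ) : ℝ) := by exact_mod_cast hb0
    have h3 : ((a % (L : ℤ) : ℤ) : ℝ) < (L : ℝ) := by exact_mod_cast haL
    have h4 : ((b % (L : ℤ) : ℤ) : ℝ) < (L : ℝ) := by exact_mod_cast hbL
    rw [abs_le]; constructor <;> linarith
  have h5 : |(L : ℝ) * D| ≤ |((a - b : ℤ) : ℝ)| + (L : ℝ) := by
    rw [key]
    have := abs_sub (((a - b : ℤ) : ℝ)) ((((a % (L : ℤ) : ℤ) : ℝ) - ((b % (L : ℤ) : ℤ) : ℝ)))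
    linarith
  rw [abs_mul, abs_of_pos hLr] at h5
  rw [div_add_one hLr.ne', le_div_iff₀ hLr]
  linarith

/-- [folklore] **THE SHARP WOBBLE**: `‖quo L u − quo L v‖∞ ≤ |u − v|₁/L + 1` (`L ≥ 1`). -/
theorem supNorm_quo_sub_quo_le_div {L : ℕ} (hL : 1 ≤ L) (u v : Fin (d + 1) → ℤ) :
    supNorm (quo L u - quo L v) ≤ l1 (u - v) / (L : ℝ) + 1 := by
  have hLr : (0 : ℝ) < (L : ℝ) := by exact_mod_cast hL
  refine supNorm_le_of_forall fun i => ?_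
  have h1 := abs_ediv_sub_ediv_le_div_add_one hL (u i) (v i)
  have h2 : |(((u i - v i : ℤ)) : ℝ)| ≤ l1 (u - v) := by
    unfold l1
    have : |(((u - v) i : ℤ) : ℝ)| ≤ ∑ μ, |(((u - v) μ : ℤ) : ℝ)| :=
      Finset.single_le_sum (f := fun μ => |(((u - v) μ : ℤ) : ℝ)|) (fun μ _ => abs_nonneg _) (Finset.mem_univ i)
    simpa only [Pi.sub_apply] using this
  have h3 : ((|(quo L u - quo L v) i| : ℤ) : ℝ) = |(((u i / (L : ℤ) : ℤ) : ℝ)) - (((v i / (L : ℤ) : ℤ) : ℝ))| := by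
    simp only [Pi.sub_apply, quo, Int.cast_abs, Int.cast_sub]
  rw [h3]
  exact h1.trans (by gcongr)

/-- [folklore] **ENVELOPE TRANSFER**: `E_c(v) ≤ e^{κ₀}·e^{(κ₀/L)|v − u|₁}·E_c(u)` (`κ₀ ≥ 0`, `L ≥ 1`). -/
theorem env_transfer {L : ℕ} (hL : 1 ≤ L) {κ₀ : ℝ} (hκ : 0 ≤ κ₀) (c u v : Fin (d + 1) → ℤ) :
    Real.exp (-(κ₀ * supNorm (quo L v - c))) ≤
      Real.exp κ₀ * Real.exp (κ₀ / L * l1 (v - u)) * Real.exp (-(κ₀ * supNorm (quo L u - c))) := by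
  rw [← Real.exp_add, ← Real.exp_add, Real.exp_le_exp]
  have h := supNorm_add_le (quo L v - c) (quo L u - quo L v)
  rw [show quo L v - c + (quo L u - quo L v) = quo L u - c by abel] at h
  have h2 := supNorm_quo_sub_quo_le_div (d := d) hL u v
  rw [l1_sub_symm u v] at h2
  have hLr : (0 : ℝ) < (L : ℝ) := by exact_mod_cast hL
  have h4 : κ₀ * supNorm (quo L u - c) ≤ κ₀ * (supNorm (quo L v - c) + (l1 (v - u) / L + 1)) :=
    mul_le_mul_of_nonneg_left (by linarith) hκ
  have e : κ₀ * (l1 (v - u) / L) = κ₀ / L * l1 (v - u) := by ring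
  nlinarith [h4, e]

/-- [folklore] **LIPSCHITZ TRANSFER**: a unit-gradient envelope `|h(v + e_j) − h v| ≤ a′·E_c(v)` gives, about ANY base point `u` and for any rate
`κ ≥ κ₀/L`, `|h v − h u| ≤ (a′·e^{κ₀}·E_c(u))·|v − u|₁·e^{κ|v − u|₁}`. -/
theorem abs_sub_le_transfer {L : ℕ} (hL : 1 ≤ L) {κ₀ κ a' : ℝ} (hκ : 0 ≤ κ₀) (hκL : κ₀ / L ≤ κ) (ha' : 0 ≤ a')
    {h : (Fin (d + 1) → ℤ) → ℝ} (c : Fin (d + 1) → ℤ)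
    (hh' : ∀ v i, |h (v + Pi.single i 1) - h v| ≤ a' * Real.exp (-(κ₀ * supNorm (quo L v - c)))) (u v : Fin (d + 1) → ℤ) :
    |h v - h u| ≤ (a' * Real.exp κ₀ * Real.exp (-(κ₀ * supNorm (quo L u - c)))) * l1 (v - u) * Real.exp (κ * l1 (v - u)) := by
  have hκ' : 0 ≤ κ := le_trans (by positivity) hκL
  refine abs_sub_le_of_unit_steps (f := h) (by positivity) hκ' (fun p i => ?_) v
  refine (hh' p i).trans ?_
  have hw := env_transfer (d := d) hL hκ c u p
  have hg : Real.exp (κ₀ / L * l1 (p - u)) ≤ Real.exp (κ * l1 (p - u)) := by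
    rw [Real.exp_le_exp]; exact mul_le_mul_of_nonneg_right hκL (l1_nonneg _)
  have h0 : 0 ≤ Real.exp (-(κ₀ * supNorm (quo L u - c))) := (Real.exp_pos _).le
  calc a' * Real.exp (-(κ₀ * supNorm (quo L p - c)))
      ≤ a' * (Real.exp κ₀ * Real.exp (κ₀ / L * l1 (p - u)) * Real.exp (-(κ₀ * supNorm (quo L u - c)))) :=
        mul_le_mul_of_nonneg_left hw ha'
    _ ≤ a' * (Real.exp κ₀ * Real.exp (κ * l1 (p - u)) * Real.exp (-(κ₀ * supNorm (quo L u - c)))) := by gcongr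
    _ = _ := by ring

/-- [folklore] **THE BLOCK-POSITION SUM AGAINST A DECAY**: for the points `p = L•c + t`, `t ∈ box L`, of the block labelled `c` (so `quo L p = c`),
`Σ_{t ∈ box} e^{−δ′|p_t − x|₁} ≤ e^{κ₀}·E_c(x)·Zl(δ′ − κ)` whenever `κ₀/L ≤ κ < δ′` — the position block sum costs a lattice constant and RETURNS the
position envelope at `x`. -/
theorem sum_box_exp_le {L : ℕ} (hL : 1 ≤ L) {κ₀ κ δ' : ℝ} (hκ : 0 ≤ κ₀) (hκL : κ₀ / L ≤ κ) (hδ' : κ < δ') (c x : Fin (d + 1) → ℤ) :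
    ∑ t ∈ box (d + 1) L, Real.exp (-δ' * l1 ((L : ℤ) • c + toSite t - x))
      ≤ Real.exp κ₀ * Real.exp (-(κ₀ * supNorm (quo L x - c))) * Zl (d + 1) (δ' - κ) := by
  haveI : NeZero L := ⟨by omega⟩
  have hgap : 0 < δ' - κ := sub_pos.2 hδ'
  -- each term: transfer the (trivial) envelope of `p_t` to `x`
  have hpt : ∀ t ∈ box (d + 1) L, Real.exp (-δ' * l1 ((L : ℤ) • c + toSite t - x))
      ≤ Real.exp κ₀ * Real.exp (-(κ₀ * supNorm (quo L x - c))) * Real.exp (-(δ' - κ) * l1 ((L : ℤ) • c + toSite t - x)) := by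
    intro t ht
    have hq : quo L ((L : ℤ) • c + toSite t) = c := quo_zsmul_add_toSite (N := L) c ht
    have hw := env_transfer (d := d) hL hκ c x ((L : ℤ) • c + toSite t)
    -- `E_c(p_t) = 1`
    have h1 : Real.exp (-(κ₀ * supNorm (quo L ((L : ℤ) • c + toSite t) - c))) = 1 := by
      rw [hq, sub_self]
      have : supNorm (0 : Fin (d + 1) → ℤ) = 0 := by
        apply le_antisymm
        · exact supNorm_le_of_forall fun i => by simp
        · exact supNorm_nonneg _
      rw [this, mul_zero, neg_zero, Real.exp_zero]
    have hg : Real.exp (κ₀ / L * l1 ((L : ℤ) • c + toSite t - x)) ≤ Real.exp (κ * l1 ((L : ℤ) • c + toSite t - x)) := by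
      rw [Real.exp_le_exp]; exact mul_le_mul_of_nonneg_right hκL (l1_nonneg _)
    -- so `1 ≤ e^{κ₀} e^{κ|p−x|} E_c(x)`
    have h2 : Real.exp (-δ' * l1 ((L : ℤ) • c + toSite t - x))
        = Real.exp (-(δ' - κ) * l1 ((L : ℤ) • c + toSite t - x)) * (Real.exp (κ * l1 ((L : ℤ) • c + toSite t - x)))⁻¹ := by
      rw [← Real.exp_neg, ← Real.exp_add]; congr 1; ring
    rw [h2]
    have hpos : 0 < Real.exp (κ * l1 ((L : ℤ) • c + toSite t - x)) := Real.exp_pos _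
    rw [mul_inv_le_iff₀ hpos]
    have h0 : 0 ≤ Real.exp (-(δ' - κ) * l1 ((L : ℤ) • c + toSite t - x)) := (Real.exp_pos _).le
    have h00 : 0 ≤ Real.exp κ₀ * Real.exp (-(κ₀ * supNorm (quo L x - c))) := by positivity
    calc Real.exp (-(δ' - κ) * l1 ((L : ℤ) • c + toSite t - x))
        = Real.exp (-(δ' - κ) * l1 ((L : ℤ) • c + toSite t - x)) * 1 := (mul_one _).symm
      _ ≤ Real.exp (-(δ' - κ) * l1 ((L : ℤ) • c + toSite t - x)) *
          (Real.exp κ₀ * Real.exp (κ₀ / ↑L * l1 ((L : ℤ) • c + toSite t - x)) * Real.exp (-(κ₀ * supNorm (quo L x - c)))) := by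
          rw [← h1]; exact mul_le_mul_of_nonneg_left hw h0
      _ ≤ Real.exp (-(δ' - κ) * l1 ((L : ℤ) • c + toSite t - x)) *
          (Real.exp κ₀ * Real.exp (κ * l1 ((L : ℤ) • c + toSite t - x)) * Real.exp (-(κ₀ * supNorm (quo L x - c)))) := by
          gcongr
      _ = _ := by ring
  refine (Finset.sum_le_sum hpt).trans ?_
  rw [← Finset.mul_sum]
  refine mul_le_mul_of_nonneg_left ?_ (by positivity)
  -- the finite block sum is at most the full lattice sum `Zl`
  have hinj : Set.InjOn (fun t : Fin (d + 1) → ℕ => (L : ℤ) • c + toSite t) (box (d + 1) L : Set (Fin (d + 1) → ℕ)) := by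
    intro t _ t' _ htt
    have : toSite (d := d + 1) t = toSite t' := add_left_cancel htt
    funext i
    have hi := congrFun this i
    simp only [toSite] at hi
    exact_mod_cast hi
  rw [← Finset.sum_image (f := fun p => Real.exp (-(δ' - κ) * l1 (p - x))) hinj, ← tsum_exp_shift' (D := d + 1) x]
  exact Summable.sum_le_tsum _ (fun p _ => (Real.exp_pos _).le) (summable_exp_shift' hgap x)

/-! ## §2 Summation bricks about a base point -/

/-- [folklore] **SUP × DECAY**: `|ψ| ≤ γ`, `|φ v| ≤ B·e^{−δ′|v−u|₁}` ⇒ summable and `|Σ' ψ·φ| ≤ γ·B·Zl δ′`. -/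
theorem abs_tsum_sup_mul_le {ψ φ : (Fin (d + 1) → ℤ) → ℝ} {u : Fin (d + 1) → ℤ} {γ B δ' : ℝ} (hδ' : 0 < δ') (hγ : 0 ≤ γ)
    (hψ : ∀ v, |ψ v| ≤ γ) (hφ : ∀ v, |φ v| ≤ B * Real.exp (-δ' * l1 (v - u))) :
    (Summable fun v => ψ v * φ v) ∧ |∑' v, ψ v * φ v| ≤ γ * B * Zl (d + 1) δ' := by
  have hB : 0 ≤ B := by
    have h0 := hφ u
    rw [sub_self, show l1 (0 : Fin (d + 1) → ℤ) = 0 by simp [l1], mul_zero, Real.exp_zero, mul_one] at h0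
    exact (abs_nonneg _).trans h0
  have hpt : ∀ v, ‖ψ v * φ v‖ ≤ γ * B * Real.exp (-δ' * l1 (v - u)) := fun v => by
    rw [Real.norm_eq_abs, abs_mul]
    calc |ψ v| * |φ v| ≤ γ * (B * Real.exp (-δ' * l1 (v - u))) := mul_le_mul (hψ v) (hφ v) (abs_nonneg _) hγ
      _ = _ := by ring
  have hs := (summable_exp_shift' hδ' u).mul_left (γ * B)
  refine ⟨Summable.of_norm_bounded hs hpt, ?_⟩
  have hb := tsum_of_norm_bounded hs.hasSum hpt
  rw [Real.norm_eq_abs, tsum_mul_left, tsum_exp_shift'] at hb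
  exact hb

/-- [folklore] **FIRST MOMENT × DECAY**: `|ψ v| ≤ γ·|v−u|₁·e^{κ|v−u|₁}`, `|φ v| ≤ B·e^{−δ′|v−u|₁}`, `0 ≤ κ < δ′` ⇒ summable and
`|Σ' ψ·φ| ≤ γ·B·(2/(δ′−κ))·Zl((δ′−κ)/2)` (`LatticeFreeze.mul_exp_neg_le`). -/
theorem abs_tsum_moment_mul_le {ψ φ : (Fin (d + 1) → ℤ) → ℝ} {u : Fin (d + 1) → ℤ} {γ B κ δ' : ℝ} (hκδ : κ < δ')
    (hγ : 0 ≤ γ) (hψ : ∀ v, |ψ v| ≤ γ * l1 (v - u) * Real.exp (κ * l1 (v - u)))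
    (hφ : ∀ v, |φ v| ≤ B * Real.exp (-δ' * l1 (v - u))) :
    (Summable fun v => ψ v * φ v) ∧ |∑' v, ψ v * φ v| ≤ γ * B * (2 / (δ' - κ) * Zl (d + 1) ((δ' - κ) / 2)) := by
  have hB : 0 ≤ B := by
    have h0 := hφ u
    rw [sub_self, show l1 (0 : Fin (d + 1) → ℤ) = 0 by simp [l1], mul_zero, Real.exp_zero, mul_one] at h0
    exact (abs_nonneg _).trans h0
  have hgap : 0 < δ' - κ := sub_pos.2 hκδ
  have hpt : ∀ v, ‖ψ v * φ v‖ ≤ γ * B * (2 / (δ' - κ)) * Real.exp (-((δ' - κ) / 2) * l1 (v - u)) := fun v => by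
    rw [Real.norm_eq_abs, abs_mul]
    have hm := mul_exp_neg_le hgap (l1 (v - u))
    have e : Real.exp (κ * l1 (v - u)) * Real.exp (-δ' * l1 (v - u)) = Real.exp (-(δ' - κ) * l1 (v - u)) := by
      rw [← Real.exp_add]; congr 1; ring
    calc |ψ v| * |φ v| ≤ (γ * l1 (v - u) * Real.exp (κ * l1 (v - u))) * (B * Real.exp (-δ' * l1 (v - u))) :=
          mul_le_mul (hψ v) (hφ v) (abs_nonneg _) (by have := l1_nonneg (v - u); positivity)
      _ = γ * B * (l1 (v - u) * (Real.exp (κ * l1 (v - u)) * Real.exp (-δ' * l1 (v - u)))) := by ring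
      _ = γ * B * (l1 (v - u) * Real.exp (-(δ' - κ) * l1 (v - u))) := by rw [e]
      _ ≤ γ * B * (2 / (δ' - κ) * Real.exp (-((δ' - κ) / 2) * l1 (v - u))) := mul_le_mul_of_nonneg_left hm (by positivity)
      _ = _ := by ring
  have hs := (summable_exp_shift' (half_pos hgap) u).mul_left (γ * B * (2 / (δ' - κ)))
  refine ⟨Summable.of_norm_bounded hs hpt, ?_⟩
  have hb := tsum_of_norm_bounded hs.hasSum hpt
  rw [Real.norm_eq_abs, tsum_mul_left, tsum_exp_shift'] at hb
  refine hb.trans (le_of_eq ?_)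
  ring

/-- [folklore] Re-centring three decays from the first slot `v` to the kernel site `x` (triangle inequality; rate `δ → δ/3`). -/
theorem recenter₃ {δ : ℝ} (hδ : 0 ≤ δ) (v v' x p : Fin (d + 1) → ℤ) :
    Real.exp (-δ * l1 (v' - v)) * Real.exp (-δ * (l1 (x - v) + l1 (p - v)))
      ≤ Real.exp (-(δ / 3) * l1 (v - x)) * Real.exp (-(δ / 3) * l1 (v' - x)) * Real.exp (-(δ / 3) * l1 (p - x)) := by
  rw [← Real.exp_add, ← Real.exp_add, ← Real.exp_add, Real.exp_le_exp]
  have h1 := l1_sub_triangle v' v x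
  have h2 := l1_sub_triangle p v x
  have h3 := l1_sub_symm x v
  have h4 := l1_nonneg (v' - v); have h5 := l1_nonneg (p - v); have h6 := l1_nonneg (v - x)
  nlinarith

/-- [folklore] Re-centring two decays (rate `δ → δ/3`). -/
theorem recenter₂ {δ : ℝ} (hδ : 0 ≤ δ) (v x p : Fin (d + 1) → ℤ) :
    Real.exp (-δ * (l1 (x - v) + l1 (p - v))) ≤ Real.exp (-(δ / 3) * l1 (v - x)) * Real.exp (-(δ / 3) * l1 (p - x)) := by
  rw [← Real.exp_add, Real.exp_le_exp]
  have h2 := l1_sub_triangle p v x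
  have h3 := l1_sub_symm x v
  have h5 := l1_nonneg (p - v); have h6 := l1_nonneg (v - x)
  nlinarith

/-! ## §3 The core: one output entry of the three-leg push with block-summed position -/

section Core

variable {L : ℕ} {κ₀ δ a a' aρ C g : ℝ} {h₁ h₂ ρ : (Fin (d + 1) → ℤ) → ℝ}
  {W : (Fin (d + 1) → ℤ) → (Fin (d + 1) → ℤ) → (Fin (d + 1) → ℤ) → (Fin (d + 1) → ℤ) → ℝ}
  {c₁ c₂ c₃ c₄ : Fin (d + 1) → ℤ}
  (hL : 1 ≤ L) (hκ : 0 < κ₀) (hδ : 0 < δ) (hgap : κ₀ ≤ δ / 6 * L)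
  (ha : 0 ≤ a) (ha' : 0 ≤ a') (haρ : 0 ≤ aρ) (hC : 0 ≤ C) (hg : 0 ≤ g)
  (hh₁ : ∀ v, |h₁ v| ≤ a * Real.exp (-(κ₀ * supNorm (quo L v - c₁))))
  (hh₁' : ∀ v i, |h₁ (v + Pi.single i 1) - h₁ v| ≤ a' * Real.exp (-(κ₀ * supNorm (quo L v - c₁))))
  (hh₂ : ∀ v, |h₂ v| ≤ a * Real.exp (-(κ₀ * supNorm (quo L v - c₂))))
  (hh₂' : ∀ v i, |h₂ (v + Pi.single i 1) - h₂ v| ≤ a' * Real.exp (-(κ₀ * supNorm (quo L v - c₂))))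
  (hρ : ∀ x, |ρ x| ≤ aρ * Real.exp (-(κ₀ * supNorm (quo L x - c₃))))
  (hW : ∀ v v' x p, |W v v' x p| ≤ C * Real.exp (-δ * l1 (v' - v)) * Real.exp (-δ * (l1 (x - v) + l1 (p - v))))
  (hq₂ : ∀ v x p, |∑' v', W v v' x p| ≤ g * Real.exp (-δ * (l1 (x - v) + l1 (p - v))))
  (hq₁ : ∀ v' x p, |∑' v, W v v' x p| ≤ g * Real.exp (-δ * (l1 (x - v') + l1 (p - v'))))
  (hq₁₂ : ∀ x p, |∑' v, ∑' v', W v v' x p| ≤ g * Real.exp (-δ * l1 (p - x)))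

include hL hgap in
/-- [folklore] The rate bookkeeping: `κ₀/L ≤ δ/6 < δ/3`. -/
theorem rate_gap : κ₀ / L ≤ δ / 6 := by
  have hLr : (0 : ℝ) < (L : ℝ) := by exact_mod_cast hL
  rw [div_le_iff₀ hLr]; exact hgap

include hL hκ hδ hgap hC hW in
/-- [folklore] **THE BLOCK-SUMMED TABLE, RE-CENTRED AT THE KERNEL SITE**:
`|Σ_{t ∈ box} W v v′ x p_t| ≤ (C·e^{κ₀}·Zl(δ/6)·E_{c₄}(x))·e^{−(δ/3)|v−x|₁}·e^{−(δ/3)|v′−x|₁}` — the position block returns its envelope at `x`. -/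
theorem abs_boxW_le (v v' x : Fin (d + 1) → ℤ) :
    |∑ t ∈ box (d + 1) L, W v v' x ((L : ℤ) • c₄ + toSite t)|
      ≤ (C * Real.exp κ₀ * Zl (d + 1) (δ / 6) * Real.exp (-(κ₀ * supNorm (quo L x - c₄)))) *
          Real.exp (-(δ / 3) * l1 (v - x)) * Real.exp (-(δ / 3) * l1 (v' - x)) := by
  have hr := rate_gap (κ₀ := κ₀) (δ := δ) hL hgap
  have hbox := sum_box_exp_le (d := d) hL hκ.le (κ := δ / 6) (δ' := δ / 3) hr (by linarith) c₄ x
  rw [show δ / 3 - δ / 6 = δ / 6 by ring] at hbox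
  calc |∑ t ∈ box (d + 1) L, W v v' x ((L : ℤ) • c₄ + toSite t)|
      ≤ ∑ t ∈ box (d + 1) L, |W v v' x ((L : ℤ) • c₄ + toSite t)| := Finset.abs_sum_le_sum_abs _ _
    _ ≤ ∑ t ∈ box (d + 1) L, C * (Real.exp (-(δ / 3) * l1 (v - x)) * Real.exp (-(δ / 3) * l1 (v' - x)) *
          Real.exp (-(δ / 3) * l1 ((L : ℤ) • c₄ + toSite t - x))) := Finset.sum_le_sum fun t _ => by
        refine (hW v v' x _).trans ?_
        rw [mul_assoc]
        exact mul_le_mul_of_nonneg_left (recenter₃ hδ.le v v' x _) hC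
    _ = C * (Real.exp (-(δ / 3) * l1 (v - x)) * Real.exp (-(δ / 3) * l1 (v' - x))) *
          ∑ t ∈ box (d + 1) L, Real.exp (-(δ / 3) * l1 ((L : ℤ) • c₄ + toSite t - x)) := by
        rw [Finset.mul_sum]; refine Finset.sum_congr rfl fun t _ => by ring
    _ ≤ C * (Real.exp (-(δ / 3) * l1 (v - x)) * Real.exp (-(δ / 3) * l1 (v' - x))) *
          (Real.exp κ₀ * Real.exp (-(κ₀ * supNorm (quo L x - c₄))) * Zl (d + 1) (δ / 6)) :=
        mul_le_mul_of_nonneg_left hbox (by positivity)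
    _ = _ := by ring

include hL hκ hδ hgap hg hq₂ in
/-- [folklore] The block-summed SECOND-SLOT CHARGE, re-centred: `|Σ_t Σ'_{v′} W v v′ x p_t| ≤ (g·e^{κ₀}·Zl(δ/6)·E_{c₄}(x))·e^{−(δ/3)|v−x|₁}`. -/
theorem abs_boxq₂_le (v x : Fin (d + 1) → ℤ) :
    |∑ t ∈ box (d + 1) L, ∑' v', W v v' x ((L : ℤ) • c₄ + toSite t)|
      ≤ (g * Real.exp κ₀ * Zl (d + 1) (δ / 6) * Real.exp (-(κ₀ * supNorm (quo L x - c₄)))) * Real.exp (-(δ / 3) * l1 (v - x)) := by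
  have hr := rate_gap (κ₀ := κ₀) (δ := δ) hL hgap
  have hbox := sum_box_exp_le (d := d) hL hκ.le (κ := δ / 6) (δ' := δ / 3) hr (by linarith) c₄ x
  rw [show δ / 3 - δ / 6 = δ / 6 by ring] at hbox
  calc |∑ t ∈ box (d + 1) L, ∑' v', W v v' x ((L : ℤ) • c₄ + toSite t)|
      ≤ ∑ t ∈ box (d + 1) L, |∑' v', W v v' x ((L : ℤ) • c₄ + toSite t)| := Finset.abs_sum_le_sum_abs _ _
    _ ≤ ∑ t ∈ box (d + 1) L, g * (Real.exp (-(δ / 3) * l1 (v - x)) * Real.exp (-(δ / 3) * l1 ((L : ℤ) • c₄ + toSite t - x))) :=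
        Finset.sum_le_sum fun t _ => (hq₂ v x _).trans (mul_le_mul_of_nonneg_left (recenter₂ hδ.le v x _) hg)
    _ = g * Real.exp (-(δ / 3) * l1 (v - x)) * ∑ t ∈ box (d + 1) L, Real.exp (-(δ / 3) * l1 ((L : ℤ) • c₄ + toSite t - x)) := by
        rw [Finset.mul_sum]; refine Finset.sum_congr rfl fun t _ => by ring
    _ ≤ g * Real.exp (-(δ / 3) * l1 (v - x)) * (Real.exp κ₀ * Real.exp (-(κ₀ * supNorm (quo L x - c₄))) * Zl (d + 1) (δ / 6)) :=
        mul_le_mul_of_nonneg_left hbox (by positivity)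
    _ = _ := by ring

include hL hκ hδ hgap hg hq₁ in
/-- [folklore] The block-summed FIRST-SLOT CHARGE, re-centred: `|Σ_t Σ'_v W v v′ x p_t| ≤ (g·e^{κ₀}·Zl(δ/6)·E_{c₄}(x))·e^{−(δ/3)|v′−x|₁}`. -/
theorem abs_boxq₁_le (v' x : Fin (d + 1) → ℤ) :
    |∑ t ∈ box (d + 1) L, ∑' v, W v v' x ((L : ℤ) • c₄ + toSite t)|
      ≤ (g * Real.exp κ₀ * Zl (d + 1) (δ / 6) * Real.exp (-(κ₀ * supNorm (quo L x - c₄)))) * Real.exp (-(δ / 3) * l1 (v' - x)) := by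
  have hr := rate_gap (κ₀ := κ₀) (δ := δ) hL hgap
  have hbox := sum_box_exp_le (d := d) hL hκ.le (κ := δ / 6) (δ' := δ / 3) hr (by linarith) c₄ x
  rw [show δ / 3 - δ / 6 = δ / 6 by ring] at hbox
  calc |∑ t ∈ box (d + 1) L, ∑' v, W v v' x ((L : ℤ) • c₄ + toSite t)|
      ≤ ∑ t ∈ box (d + 1) L, |∑' v, W v v' x ((L : ℤ) • c₄ + toSite t)| := Finset.abs_sum_le_sum_abs _ _
    _ ≤ ∑ t ∈ box (d + 1) L, g * (Real.exp (-(δ / 3) * l1 (v' - x)) * Real.exp (-(δ / 3) * l1 ((L : ℤ) • c₄ + toSite t - x))) :=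
        Finset.sum_le_sum fun t _ => (hq₁ v' x _).trans (mul_le_mul_of_nonneg_left (recenter₂ hδ.le v' x _) hg)
    _ = g * Real.exp (-(δ / 3) * l1 (v' - x)) * ∑ t ∈ box (d + 1) L, Real.exp (-(δ / 3) * l1 ((L : ℤ) • c₄ + toSite t - x)) := by
        rw [Finset.mul_sum]; refine Finset.sum_congr rfl fun t _ => by ring
    _ ≤ g * Real.exp (-(δ / 3) * l1 (v' - x)) * (Real.exp κ₀ * Real.exp (-(κ₀ * supNorm (quo L x - c₄))) * Zl (d + 1) (δ / 6)) :=
        mul_le_mul_of_nonneg_left hbox (by positivity)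
    _ = _ := by ring

include hL hκ hδ hgap hg hq₁₂ in
/-- [folklore] The block-summed DOUBLE CHARGE: `|Σ_t Σ'_v Σ'_{v′} W v v′ x p_t| ≤ g·e^{κ₀}·Zl(δ/6)·E_{c₄}(x)`. -/
theorem abs_boxq₁₂_le (x : Fin (d + 1) → ℤ) :
    |∑ t ∈ box (d + 1) L, ∑' v, ∑' v', W v v' x ((L : ℤ) • c₄ + toSite t)|
      ≤ g * Real.exp κ₀ * Zl (d + 1) (δ / 6) * Real.exp (-(κ₀ * supNorm (quo L x - c₄))) := by
  have hr := rate_gap (κ₀ := κ₀) (δ := δ) hL hgap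
  have hbox := sum_box_exp_le (d := d) hL hκ.le (κ := δ / 6) (δ' := δ / 3) hr (by linarith) c₄ x
  rw [show δ / 3 - δ / 6 = δ / 6 by ring] at hbox
  calc |∑ t ∈ box (d + 1) L, ∑' v, ∑' v', W v v' x ((L : ℤ) • c₄ + toSite t)|
      ≤ ∑ t ∈ box (d + 1) L, |∑' v, ∑' v', W v v' x ((L : ℤ) • c₄ + toSite t)| := Finset.abs_sum_le_sum_abs _ _
    _ ≤ ∑ t ∈ box (d + 1) L, g * Real.exp (-(δ / 3) * l1 ((L : ℤ) • c₄ + toSite t - x)) :=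
        Finset.sum_le_sum fun t _ => (hq₁₂ x _).trans (mul_le_mul_of_nonneg_left (by
          rw [Real.exp_le_exp]; have := l1_nonneg ((L : ℤ) • c₄ + toSite t - x); nlinarith) hg)
    _ = g * ∑ t ∈ box (d + 1) L, Real.exp (-(δ / 3) * l1 ((L : ℤ) • c₄ + toSite t - x)) := by rw [Finset.mul_sum]
    _ ≤ g * (Real.exp κ₀ * Real.exp (-(κ₀ * supNorm (quo L x - c₄))) * Zl (d + 1) (δ / 6)) := mul_le_mul_of_nonneg_left hbox hg
    _ = _ := by ring


end Core

end Summit.QuantumFields.BalabanUV.Beta.GAN24.ThreeLegFreezeBricks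

end
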